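import Literature.MathematicalPhysics.QuantumFieldTheory.Balaban1983to89.B9Thm313WholeLeafLeft
import Literature.MathematicalPhysics.QuantumFieldTheory.Balaban1983to89.B9Ineq347CoReading
import Literature.MathematicalPhysics.QuantumFieldTheory.Balaban1983to89.B9CoRealizesRel

/-!
# `Balaban1983to89.B9Thm313WholeLeafRel` — [B9] Theorem 3.13 (p. 426) AS THE WHOLE PRINTED LEAF `B9.Thm313Printed` AT THE PINS OF THEOREM 3.12 — the
# row-21 leaf with BOTH co-readings repaired: (3.42) through `B9CoRealizesRel.CoRealizesRel` (block equivalence `Rel`, multiplicity `m`), (3.47) through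
# `B9Ineq347CoReading.CoReadsGlob`

T. Bałaban, *Propagators for lattice gauge theories in a background field*, Commun. Math. Phys. **99** (1985) 389–434
[`Balaban1985BackgroundPropagators`, "B9"]; [4] = T. Bałaban, *Propagators and renormalization transformations for lattice
gauge theories. II*, Commun. Math. Phys. **96** (1984) 223–250 [`Balaban1984PropagatorsII`].

statement-level skeleton of published theorems with citation tags; proofs where landed; nothing here is a claim about the
Yang–Mills mass gap

THE PRINTED LOCI are those of `…B9Thm313WholeLeafCoGlob` (verbatim there).

WHY THIS FILE (successor of `…B9Thm313WholeLeafCoGlob.thm313Printed_of_stepDG`, same seat).  As for row 20 (`…B9Thm312WholeLeafRel`): the (3.42) co-readings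
`hco`, `hco1` (n06-c's `CoRealizes`, unsatisfiable at the record — `B9CoRealizesSharedBlock`) become `hcoR`, `hco1R` relative to a block equivalence `Rel i` on
the sites, with the member-uniform data `hsat` (saturation of `maj342 (geo i) n B δ`) and `hmult` (class size ≦ m); the (3.42) clauses of 𝔊 come from
`clause342_of_hasMajorantHom_rel` with constant m·C_sup; everything else VERBATIM.  `Rel i := Eq`, `m := 1` recovers the predecessor.

WHAT THIS FILE PROVES (one theorem — 0 `def`, 0 named fact, 0 sorry): ★ `thm313Printed_of_stepRel` — conclusion and pins of row 21 unchanged; PROVED INSIDE: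
(3.42)₁,₂,₃ (constant m·C_sup) and (3.47)₀,₁,₂ of 𝔊 at the rate ρ′, the pins.  RESIDUAL DISPLAYED (`hres`, unchanged): (3.46) and (3.43)–(3.45) of 𝔊.

HONEST SCOPE.  Nothing of print is asserted: every analytic input is a HYPOTHESIS of printed ∕ definitional shape.  Kernel-checked bookkeeping — NOT a
node discharge, NOT summit progress; one finite lattice at a time; nothing continuum, nothing about the mass gap.  Cell `pub-ymgap` (HUMAN RULING
D-0062), Track A node N06 [B9], N06-ASSIGNMENT v1 row 21 (bundle F7), seat `pub-ymgap-dag-n06-l` (g3), 2026-08-27.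
-/

namespace Literature.MathematicalPhysics.QuantumFieldTheory.Balaban1983to89.B9Thm313WholeLeafRel

open Literature.MathematicalPhysics.QuantumFieldTheory.Balaban1983to89
open Finset B6RandomWalk B6RandomWalkHom B9Thm34Ext B9Thm37GlueCor36 B11SectG B9SectDSup
open B9Thm37AllNorms B9Thm37AllNormsInstances B9FromB6 B9FromB6ModelSignsOn B9SectBStepWhole B9Thm312Whole B9Thm312WholeLeaf
open B9Thm312WholeLeft B9Thm313Whole B9Thm313WholeLeft B9Thm312WholeLeafLeftGlob B9Ineq347CoReading B9SectCDiffDict B9CoRealizesRel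

noncomputable section

section Family

variable {I : Type} {c35 : ℝ} {geo : I → B9.Geometry} {bg : I → B9.Backgrounds}
variable [∀ i, Fintype (geo i).Site]
variable {X Y Z W : I → Type} [∀ i, Fintype (X i)] [∀ i, DecidableEq (X i)] [∀ i, Fintype (Y i)]
  [∀ i, Fintype (Z i)] [∀ i, Fintype (W i)]

omit [∀ i, Fintype (X i)] [∀ i, DecidableEq (X i)] [∀ i, Fintype (Y i)] [∀ i, Fintype (Z i)] [∀ i, Fintype (W i)]
  [∀ i, Fintype (geo i).Site] in
/-- Arithmetic of *"for α₀ sufficiently small"*: t ≧ 0 and m ≦ (2(t + 1))⁻¹ give tm ≦ ½. [folklore] -/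
private theorem small_aux'' {t m : ℝ} (ht : 0 ≤ t) (hm : m ≤ (2 * (t + 1))⁻¹) : t * m ≤ 1 / 2 := by
  have hpos : 0 < 2 * (t + 1) := by linarith
  have h1 : t * m ≤ t * (2 * (t + 1))⁻¹ := mul_le_mul_of_nonneg_left hm ht
  have h2 : t * (2 * (t + 1))⁻¹ ≤ 1 / 2 := by
    rw [← div_eq_mul_inv, div_le_iff₀ hpos]
    linarith
  linarith

/-- ★ **THEOREM 3.13 AS THE WHOLE PRINTED LEAF `B9.Thm313Printed`, AT THE PINS OF THEOREM 3.12 — BOTH CO-READINGS REPAIRED** (p. 426; p. 397 (3.42)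
with y, y′ ∈ 𝔅 BLOCKS).  Inputs: those of `B9Thm313WholeLeafCoGlob.thm313Printed_of_stepDG` VERBATIM except that `hco`, `hco1` (n06-c's `CoRealizes`, unsatisfiable
at the record) are REPLACED by `hcoR`, `hco1R` (`CoRealizesRel … (Rel i) …`) together with `hsat` (saturation of `maj342 (geo i) n B δ` for `Rel i`) and
`hmult` (class size ≦ m).  PROVED INSIDE: (3.42)₁,₂,₃ of 𝔊 at the rate ρ′ with constant m·C_sup (`clause342_of_hasMajorantHom_rel`); (3.47)₀,₁,₂ of 𝔊
(`glob_of_hasMajorantHom`); the pins.  RESIDUAL DISPLAYED (`hres`): (3.46), (3.43)–(3.45) of 𝔊.  Nothing of print asserted; NOT a node discharge.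
[cite: Balaban1985BackgroundPropagators, Thm 3.13 p.426 + (3.152)–(3.153) p.426 + (3.138) p.423 + (3.41)–(3.42) p.397 + (3.47) p.398; Balaban1984PropagatorsII, (2.51)–(2.52) p.232 + Lemma 2.1 (2.60)–(2.61) p.234] -/
theorem thm313Printed_of_stepRel (𝔬 : ∀ i, Ops (geo i) (bg i) (X i) (Y i) (Z i) (W i)) (R₀ : I → ℝ) (H₀ : I → Prop)
    (GG : ∀ i, B9.KernelFamily (geo i) (bg i)) (bH : ∀ i, BlockNorm (toB6 (geo i) (R₀ i) (H₀ i)) (W i → ℝ))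
    (ev : ∀ i, (geo i).Loc → X i → ℝ) (evY : ∀ i, (geo i).Loc → Y i → ℝ) {P : ∀ i, (geo i).Loc → Prop}
    (Rel : ∀ i, (geo i).Site → (geo i).Site → Prop) [∀ i, DecidableRel (Rel i)] (m : ℕ)
    (θ₁ θD r₁ B₀ δ₀ δK σ c ρ a₁ M₁ ML B₁ δ₁ B₃ δ₃ ρ' α Lc κ₀ : ℝ) (Bβ Bε : ℝ → ℝ) (Bεβ : ℝ → ℝ → ℝ)
    (hθ₁ : 0 ≤ θ₁) (hθD : 0 ≤ θD) (hr₁ : 0 ≤ r₁) (hB₀ : 0 ≤ B₀) (hB₃ : 0 ≤ B₃) (hσ : 0 ≤ σ) (hρ' : 0 < ρ') (hρ'ρ : ρ' + 3 * σ ≤ ρ)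
    (hρS : ρ ≤ δ₀) (hρ₃ : ρ ≤ δ₃) (hρδ : ρ + σ ≤ δK) (hc : 0 ≤ c) (ha₁ : 0 < a₁) (hM₁ : 0 < M₁) (hδ₁ : 0 < δ₁)
    (hBβ : ∀ β, 0 ≤ Bβ β) (hBε : ∀ ε, 0 ≤ Bε ε) (hBεβ : ∀ ε β, 0 ≤ Bεβ ε β)
    (hgeo : ∀ i, GeoOK (geo i)) (S : ∀ i, ModelSignsOn (geo i) (P i))
    (hL1 : ∀ i, 1 ≤ (geo i).L) (hLle : ∀ i, (geo i).L ≤ Lc) (hη : ∀ i, 0 < (geo i).eta) (hκ : ∀ i, (bH i).κ ≤ κ₀)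
    (hrow : ∀ i, ML ≤ (geo i).M → RowSum (toB6 (geo i) (R₀ i) (H₀ i)) σ c)
    (hL21 : ∀ δ : ℝ, 0 < δ → ∃ ML' c' : ℝ, Lemma21AboveG geo R₀ H₀ δ α ML' c')
    (hsat : ∀ (i : I) (n : Fin 4) (B' δ' : ℝ),
      (∀ a a' b, Rel i a a' → maj342 (geo i) n B' δ' a b = maj342 (geo i) n B' δ' a' b) ∧
      (∀ a b b', Rel i b b' → maj342 (geo i) n B' δ' a b = maj342 (geo i) n B' δ' a b'))
    (hmult : ∀ (i : I) (y' : (geo i).Site), (Finset.univ.filter (fun y'' => Rel i y'' y')).card ≤ m)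
    (hcoR : ∀ (i : I) (U : (bg i).Cfg),
      CoRealizesRel (GG i) 0 U (Rel i) (𝔬 i).blk (𝔬 i).blk (ev i) ((𝔬 i).GG U) ∧
      CoRealizesRel (GG i) 2 U (Rel i) (𝔬 i).blk (𝔬 i).blkY (evY i) ((𝔬 i).GG U ∘ₗ (𝔬 i).Dstar U))
    (hco1R : ∀ (i : I) (U : (bg i).Cfg), CoRealizesRel (GG i) 1 U (Rel i) (𝔬 i).blkY (𝔬 i).blk (ev i) ((𝔬 i).D U ∘ₗ (𝔬 i).GG U))
    (hcoG : ∀ (i : I) (U : (bg i).Cfg),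
      CoReadsGlob (GG i) 0 U (𝔬 i).blk (𝔬 i).blk (ev i) ((𝔬 i).GG U) ∧
      CoReadsGlob (GG i) 1 U (𝔬 i).blkY (𝔬 i).blk (ev i) ((𝔬 i).D U ∘ₗ (𝔬 i).GG U) ∧
      CoReadsGlob (GG i) 2 U (𝔬 i).blk (𝔬 i).blkY (evY i) ((𝔬 i).GG U ∘ₗ (𝔬 i).Dstar U))
    (hmodel : ∀ i, M₁ ≤ (geo i).M → ∀ α₀ : ℝ, 0 < α₀ → (geo i).M * α₀ ≤ a₁ →
      ∀ U : (bg i).Cfg, (bg i).Reg335 c35 α₀ U → (bg i).Reg336 c35 α₀ U →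
        Thm33G0 (𝔬 i) (R₀ i) (H₀ i) B₀ δ₀ U ∧
        Step (𝔬 i) (R₀ i) (H₀ i) (hgeo i).lenle 1 (θ₁ * ((geo i).M * α₀)) δK U ∧
        Step (𝔬 i) (R₀ i) (H₀ i) (hgeo i).lenle 2 (θ₁ * ((geo i).M * α₀)) δK U ∧
        FormSmall (𝔬 i) (r₁ * ((geo i).M * α₀)) U ∧ Identities (𝔬 i) U)
    (hleft : ∀ i, M₁ ≤ (geo i).M → ∀ α₀ : ℝ, 0 < α₀ → (geo i).M * α₀ ≤ a₁ →
      ∀ U : (bg i).Cfg, (bg i).Reg335 c35 α₀ U → (bg i).Reg336 c35 α₀ U →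
        LeftStep (𝔬 i) (R₀ i) (H₀ i) (hgeo i).lenle B₀ δ₀ (θD * ((geo i).M * α₀)) δK U)
    (hletters : ∀ i, M₁ ≤ (geo i).M → ∀ α₀ : ℝ, 0 < α₀ → (geo i).M * α₀ ≤ a₁ →
      ∀ U : (bg i).Cfg, (bg i).Reg335 c35 α₀ U → (bg i).Reg336 c35 α₀ U →
        Letters313 (𝔬 i) (R₀ i) (H₀ i) (hgeo i) B₃ δ₃ U)
    (hlettersD : ∀ i, M₁ ≤ (geo i).M → ∀ α₀ : ℝ, 0 < α₀ → (geo i).M * α₀ ≤ a₁ →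
      ∀ U : (bg i).Cfg, (bg i).Reg335 c35 α₀ U → (bg i).Reg336 c35 α₀ U →
        Letters313D (𝔬 i) (R₀ i) (H₀ i) (hgeo i) B₃ δ₃ (bH i) U)
    (hres : ∀ i, M₁ ≤ (geo i).M → ∀ α₀ : ℝ, 0 < α₀ → (geo i).M * α₀ ≤ a₁ →
      ∀ U : (bg i).Cfg, (bg i).Reg335 c35 α₀ U → (bg i).Reg336 c35 α₀ U →
        L2Block (GG i) B₁ δ₁ U ∧ B9.Ineq343_345 (GG i) Bβ Bε Bεβ δ₁ U) :
    B9.Thm313Printed c35 geo bg GG (fun i => HasRWExpOfOps (𝔬 i)) (fun i => PosDefKOfOps (𝔬 i)) := by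
  -- the constants of the leaf
  obtain ⟨MLg, cg, hLg⟩ := hL21 ρ' hρ'
  set cg' : ℝ := max cg 0 with hcg'
  have hcg'0 : 0 ≤ cg' := le_max_right _ _
  set a₀ : ℝ := min a₁ (min (2 * (θ₁ * c + 1))⁻¹ (2 * (r₁ + 1))⁻¹) with ha₀
  set C₂ : ℝ := const313 (2 * B₀) (2 * B₃) B₃ c with hC₂
  set CD : ℝ := constD313 (B₀ + θD * a₁ * (2 * B₀) * c) (θD * a₁) (2 * B₀) (2 * B₃) B₃ (max κ₀ 0) c with hCD
  set Csup : ℝ := max C₂ CD with hCsup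
  set CsupR : ℝ := (m : ℝ) * Csup with hCsupR
  set Cgl : ℝ := Csup * cg' * Lc ^ (4 : ℝ) with hCgl
  set Bout : ℝ := max (max (max CsupR Cgl) B₁) 1 with hBout
  set δout : ℝ := min ρ' δ₁ with hδout
  have ha₀pos : 0 < a₀ := lt_min ha₁ (lt_min (inv_pos.mpr (by nlinarith)) (inv_pos.mpr (by linarith)))
  have hC₂0 : 0 ≤ C₂ := const313_nonneg (by linarith) (by linarith) hB₃ hc
  have hCsup2 : C₂ ≤ Csup := le_max_left _ _
  have hCsupD : CD ≤ Csup := le_max_right _ _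
  have hCsup0 : 0 ≤ Csup := hC₂0.trans hCsup2
  have hCsupR0 : 0 ≤ CsupR := mul_nonneg (Nat.cast_nonneg m) hCsup0
  have hBoutS : CsupR ≤ Bout := ((le_max_left _ _).trans (le_max_left _ _)).trans (le_max_left _ _)
  have hBoutG : Cgl ≤ Bout := ((le_max_right _ _).trans (le_max_left _ _)).trans (le_max_left _ _)
  have hBoutB₁ : B₁ ≤ Bout := (le_max_right _ _).trans (le_max_left _ _)
  have hBout0 : 0 ≤ Bout := zero_le_one.trans (le_max_right _ _)
  have hδρ : δout ≤ ρ' := min_le_left _ _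
  have hδδ₁ : δout ≤ δ₁ := min_le_right _ _
  refine ⟨max (max M₁ ML) MLg, δout, a₀, Bout, Bβ, Bε, Bεβ, lt_max_of_lt_left (lt_max_of_lt_left hM₁), lt_min hρ' hδ₁,
    ha₀pos, zero_lt_one.trans_le (le_max_right _ _), ?_⟩
  intro i hM α₀ hα₀ hMa U hU hU'
  have hM₁i : M₁ ≤ (geo i).M := ((le_max_left _ _).trans (le_max_left _ _)).trans hM
  have hMLi : ML ≤ (geo i).M := ((le_max_right _ _).trans (le_max_left _ _)).trans hM
  have hMLgi : MLg ≤ (geo i).M := (le_max_right _ _).trans hM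
  have hMpos : 0 < (geo i).M := hM₁.trans_le hM₁i
  have hm0 : 0 ≤ (geo i).M * α₀ := (mul_pos hMpos hα₀).le
  have hma₁ : (geo i).M * α₀ ≤ a₁ := hMa.trans (min_le_left _ _)
  have hmθ : (geo i).M * α₀ ≤ (2 * (θ₁ * c + 1))⁻¹ := hMa.trans ((min_le_right _ _).trans (min_le_left _ _))
  have hmr : (geo i).M * α₀ ≤ (2 * (r₁ + 1))⁻¹ := hMa.trans ((min_le_right _ _).trans (min_le_right _ _))
  obtain ⟨h33, hS1, hS2, hF, hI⟩ := hmodel i hM₁i α₀ hα₀ hma₁ U hU hU'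
  have hL := hletters i hM₁i α₀ hα₀ hma₁ U hU hU'
  have hLD := hlettersD i hM₁i α₀ hα₀ hma₁ U hU hU'
  have hLS := hleft i hM₁i α₀ hα₀ hma₁ U hU hU'
  obtain ⟨hl2, hho⟩ := hres i hM₁i α₀ hα₀ hma₁ U hU hU'
  have hrowi := hrow i hMLi
  obtain ⟨h260, hrowg, hsize⟩ := hLg i hMLgi
  have hrowg' : RowSum (toB6 (geo i) (R₀ i) (H₀ i)) ((1 - α) * ρ') cg' := fun y => (hrowg y).trans (le_max_left _ _)
  set θ : ℝ := θ₁ * ((geo i).M * α₀) with hθdef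
  set θ' : ℝ := θD * ((geo i).M * α₀) with hθ'def
  have hθ : 0 ≤ θ := mul_nonneg hθ₁ hm0
  have hθ' : 0 ≤ θ' := mul_nonneg hθD hm0
  have hq : θ * c ≤ 1 / 2 := by
    have h := small_aux'' (mul_nonneg hθ₁ hc) hmθ
    calc θ * c = θ₁ * c * ((geo i).M * α₀) := by rw [hθdef]; ring
      _ ≤ 1 / 2 := h
  have hq1 : θ * c < 1 := lt_one_of_le_half hq
  have hr : r₁ * ((geo i).M * α₀) < 1 := by
    have h := small_aux'' hr₁ hmr
    linarith
  have hσδ : σ ≤ δK := by linarith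
  have hinv0 : 0 ≤ (1 - θ * c)⁻¹ := inv_nonneg.mpr (by linarith)
  have hA₁ : 0 ≤ B₀ * (1 - θ * c)⁻¹ := mul_nonneg hB₀ hinv0
  have hA₃ : 0 ≤ B₃ * (1 - θ * c)⁻¹ := mul_nonneg hB₃ hinv0
  have hA₁le : B₀ * (1 - θ * c)⁻¹ ≤ 2 * B₀ := const_le_two_mul hB₀ hq
  have hA₃le : B₃ * (1 - θ * c)⁻¹ ≤ 2 * B₃ := const_le_two_mul hB₃ hq
  have hC0 : 0 ≤ const313 (B₀ * (1 - θ * c)⁻¹) (B₃ * (1 - θ * c)⁻¹) B₃ c := const313_nonneg hA₁ hA₃ hB₃ hc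
  have hCle : const313 (B₀ * (1 - θ * c)⁻¹) (B₃ * (1 - θ * c)⁻¹) B₃ c ≤ Csup :=
    (const313_mono hA₁ hA₁le hA₃ hA₃le hB₃ hc).trans hCsup2
  -- the constant of the left entry
  have hCL : 0 ≤ B₀ + θ' * (B₀ * (1 - θ * c)⁻¹) * c := add_nonneg hB₀ (mul_nonneg (mul_nonneg hθ' hA₁) hc)
  have hθ'le : θ' ≤ θD * a₁ := mul_le_mul_of_nonneg_left hma₁ hθD
  have hCLle : B₀ + θ' * (B₀ * (1 - θ * c)⁻¹) * c ≤ B₀ + θD * a₁ * (2 * B₀) * c := by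
    have h2 : θ' * (B₀ * (1 - θ * c)⁻¹) ≤ θD * a₁ * (2 * B₀) := mul_le_mul hθ'le hA₁le hA₁ (mul_nonneg hθD ha₁.le)
    have h3 : θ' * (B₀ * (1 - θ * c)⁻¹) * c ≤ θD * a₁ * (2 * B₀) * c := mul_le_mul_of_nonneg_right h2 hc
    linarith
  have hD0 : 0 ≤ constD313 (B₀ + θ' * (B₀ * (1 - θ * c)⁻¹) * c) θ' (B₀ * (1 - θ * c)⁻¹) (B₃ * (1 - θ * c)⁻¹) B₃ (bH i).κ c :=
    constD313_nonneg hCL hθ' hA₁ hA₃ hB₃ (bH i).κ_nonneg hc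
  have hDle : constD313 (B₀ + θ' * (B₀ * (1 - θ * c)⁻¹) * c) θ' (B₀ * (1 - θ * c)⁻¹) (B₃ * (1 - θ * c)⁻¹) B₃ (bH i).κ c ≤
      Csup :=
    (constD313_mono hCLle hθ' hθ'le hA₁ hA₁le hA₃ hA₃le hB₃ ((hκ i).trans (le_max_left _ _)) hc).trans hCsupD
  obtain ⟨hco0, hco2⟩ := hcoR i U
  have hco1i := hco1R i U
  obtain ⟨hg0, hg1, hg2⟩ := hcoG i U
  have hlen := (hgeo i).lenle
  -- the model majorants of 𝔊 at the rate ρ′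
  have hm0 := GG_entry0_of_letters (hgeo i) hrowi hc hθ hB₀ hB₃ hσ hρ'.le hρ'ρ hρS hρ₃ hρδ hq1 hS2.step1 h33.e0 hL hI
  have hm1 := GG_entry1_of_letters (hgeo i) hrowi hc hθ hθ' hB₀ hB₃ hσ hρ'.le hρ'ρ hρS hρ₃ hρδ hq1 hS2.step1 h33.e0 hLS hL hLD hI
  have hm2 := GG_entry2_of_letters (hgeo i) hrowi hc hθ hB₀ hB₃ hσ hρ'.le hρ'ρ hρS hρ₃ hρδ hq1 hS1.step1 h33.e2 hL hI
  -- the same majorants in the `maj342 · n Csup ρ′` shape, for the (3.47) passage on the model lattice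
  have hM0 : HasMajorantHom (g := toB6 (geo i) (R₀ i) (H₀ i)) (𝔬 i).blk (𝔬 i).blk ((𝔬 i).GG U) (maj342 (geo i) 0 Csup ρ') :=
    hasMajorantHom_maj342_zero_of_le ((hasMajorantHom_iff (g := toB6 (geo i) (R₀ i) (H₀ i)) (𝔬 i).blk _ _).2 hm0) hCle
  have hM1 : HasMajorantHom (g := toB6 (geo i) (R₀ i) (H₀ i)) (𝔬 i).blk (𝔬 i).blkY ((𝔬 i).D U ∘ₗ (𝔬 i).GG U) (maj342 (geo i) 1 Csup ρ') :=
    hasMajorantHom_maj342_one_of_le hm1 hDle hlen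
  have hM2 : HasMajorantHom (g := toB6 (geo i) (R₀ i) (H₀ i)) (𝔬 i).blkY (𝔬 i).blk ((𝔬 i).GG U ∘ₗ (𝔬 i).Dstar U) (maj342 (geo i) 2 Csup ρ') :=
    hasMajorantHom_maj342_two_of_le hm2 hCle hlen
  -- the proved clauses (3.42)₁,₂,₃ of 𝔊 at the rate ρ′ with the constant m·Csup, through the RELATIVE co-readings
  have cl0 : Clause342 (GG i) 0 CsupR ρ' U :=
    clause342_of_hasMajorantHom_rel hco0 hCsup0 hlen (hsat i 0 Csup ρ').1 (hsat i 0 Csup ρ').2 (hmult i) hM0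
  have cl1 : Clause342 (GG i) 1 CsupR ρ' U :=
    clause342_of_hasMajorantHom_rel hco1i hCsup0 hlen (hsat i 1 Csup ρ').1 (hsat i 1 Csup ρ').2 (hmult i) hM1
  have cl2 : Clause342 (GG i) 2 CsupR ρ' U :=
    clause342_of_hasMajorantHom_rel hco2 hCsup0 hlen (hsat i 2 Csup ρ').1 (hsat i 2 Csup ρ').2 (hmult i) hM2
  -- the global entries (3.47)₀,₁,₂ of 𝔊, constant Csup·c′·L⁴ ≦ Bout
  have hL0i : 0 < (geo i).L := lt_of_lt_of_le one_pos (hL1 i)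
  have hL4 : (geo i).L ^ (4 : ℝ) ≤ Lc ^ (4 : ℝ) := Real.rpow_le_rpow hL0i.le (hLle i) (by norm_num)
  have hCgl0 : 0 ≤ Csup * cg' * (geo i).L ^ (4 : ℝ) := mul_nonneg (mul_nonneg hCsup0 hcg'0) (Real.rpow_nonneg hL0i.le _)
  have hCglle : Csup * cg' * (geo i).L ^ (4 : ℝ) ≤ Bout := (mul_le_mul_of_nonneg_left hL4 (mul_nonneg hCsup0 hcg'0)).trans hBoutG
  have hglob : ∀ (n : Fin 4) (lam : (geo i).Loc) (γ : ℝ), n ≠ 3 → -4 ≤ γ → γ ≤ 4 →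
      (GG i).glob n U lam γ ≤ Bout * (geo i).wNorm γ lam :=
    glob_noLap_of_entries (PG := fun _ => True) (S i) hCgl0 hCgl0 hCgl0 hCglle hCglle hCglle
      (fun lam γ _ => glob_of_hasMajorantHom hg0 hM0 hCsup0 hcg'0 (hL1 i) (hη i) (S i).wNorm_nonneg hsize h260 hrowg' lam γ)
      (fun lam γ _ => glob_of_hasMajorantHom hg1 hM1 hCsup0 hcg'0 (hL1 i) (hη i) (S i).wNorm_nonneg hsize h260 hrowg' lam γ)
      (fun lam γ _ => glob_of_hasMajorantHom hg2 hM2 hCsup0 hcg'0 (hL1 i) (hη i) (S i).wNorm_nonneg hsize h260 hrowg' lam γ)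
      (fun _ _ _ h => absurd trivial h)
  -- everything brought to (Bout, δout)
  have w : ∀ {j : Fin 4}, Clause342 (GG i) j CsupR ρ' U → Clause342 (GG i) j Bout δout U := fun cm =>
    clause342_mono cm hCsupR0 hBoutS hδρ (S i).dist_nonneg hlen (S i).supNorm_nonneg
  exact ⟨⟨eNoLap_of_clauses (w cl0) (w cl1) (w cl2), l2Block_mono (S i) hl2 hBoutB₁ hBout0 hδδ₁, hglob⟩,
    ineq343_345_mono (S i) hho (fun _ => le_rfl) hBβ (fun _ => le_rfl) hBε (fun _ _ => le_rfl) hBεβ hδδ₁,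
    hasRWExp_of_schemas (hgeo i) hrowi hθ hσδ hq1 hS2 hI (GG i) δout, posDefK_of_schemas hr hF hI (GG i)⟩

end Family

end

end Literature.MathematicalPhysics.QuantumFieldTheory.Balaban1983to89.B9Thm313WholeLeafRel
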